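import Literature.Topology.FourManifolds.CappellShanesonClassGroupSeventysevenMain
import Literature.Topology.FourManifolds.CappellShanesonClassGroupSeventythreeGompf
import HarnessLib

/-!
# Trace `77`: Gompf's conjecture REDUCED to Iwaki's three undecided special classes `(61, 253, 77)`, `(92, 149, 77)`, `(34, 145, 77)`

The trace `77` is covered neither by Kim–Yamada's Theorem B (`[-64, 69]`, tree: `CappellShanesonThmBWindow.lean`)
nor by Iwaki's Theorem 5.1 (`-73, -69, -67, -66, 71, 72, 74, 78`, tree: `CappellShanesonIwakiWindow.lean`).  K. Iwaki,
*Infinite families of standard Cappell–Shaneson homotopy 4-spheres*, Topology Appl. 366 (2025) 109293 =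
arXiv:2404.05096, §4.3 lists the `35` ideal classes of `ℤ[θ₇₇]` (MAGMA; certified in
`…ClassGroupSeventyseven{,Rel1,Rel2,Rel3,Cls,Main}.lean`), and §5.1 explains the procedure behind Theorem 5.1: a
representative `(c, d, n)` with `n ≡ n₀ (mod d)` for a trace `n₀` where Gompf's conjecture is known moves to `A₀` by one
Gompf move (Lemma 5.2 = Kim–Yamada's Lemma 6.1); the remaining, "special", classes are treated one by one by printed
chains — none of which concerns the trace `77` ("if it is uncertain whether or not a special `(c,d,n)` is equivalent to
`(1,1,2)`, such `(c,d,n)` are double underlined").  For the row `n = 77` exactly three classes are special: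
`(61, 253, 77)`, `(92, 149, 77)`, `(34, 145, 77)` (a Gompf move changes the trace by a multiple of `d`; the nearest
candidates are `77 - 253 = -176`, `77 - 149 = -72 = 5 - 77` (the mirror of the trace itself) and `77 - 145 = -68 = 5 - 73`,
none of them a trace where the conjecture is known — the last one is itself reduced, in `…ClassGroupSeventythreeGompf.lean`,
to the four undecided classes of the trace `73`).  This file runs the procedure over the certified cover
`isConj_standardCSMatrix_of_trace_eq_seventyseven` and proves:

* `gompfConjectureForTrace_seventyseven_of` — the inductive-step form (hypotheses: Gompf's conjecture at the smaller
  traces met by the moves, all theorems of the tree, and the Gompf equivalence of the three special standard matrices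
  with `A₀`);
* `gompfConjectureForTrace_seventyseven_of_undecided` — **`GompfConjectureForTrace 77` from the three undecided classes
  alone**, and `gompfConjectureForTrace_seventyseven_iff` (the converse is trivial); the mirror `-72 = 5 - 77` by
  Kim–Yamada's Theorem A (`gompfConjectureForTrace_neg_seventytwo_of_undecided`);
* `gompfConjectureForTrace_seventyseven_of_seventythree_undecided` — the class of `(34, 145, 77)` moves to the trace
  `-68` (`gompfEquiv_standardCSMatrix_34_145_77_of_neg_sixtyeight`), so `GompfConjectureForTrace 77` also follows from
  `X_{61,253,77} ∼ A₀`, `X_{92,149,77} ∼ A₀` and the four undecided classes of the trace `73`.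

Nothing here decides the special classes; no named fact is introduced (D-0026).  (File generated by the seat's
`gen_main.py` ∕ `splitN.py` with the open-class hypotheses, lit-hodgefound p15, 2026-08-28.)

## References
* [Iwaki2025] K. Iwaki, Topology Appl. 366 (2025) 109293 (arXiv:2404.05096): §4.3 (Table, rows `n = 73, 77`), §5.1
  (Lemma 5.2, the special classes; no chain for the traces `73`, `77`), Thm. 5.1 (the known traces).
* [KimYamada2023] M. H. Kim, S. Yamada, Kyungpook Math. J. 63 (2023) 373–411: Lemma 6.1, Thm. A, Prop. 2.14.
-/

noncomputable section

open Set Polynomial Module NumberField Ideal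
open scoped NumberField MatrixGroups nonZeroDivisors
open Literature.LinearAlgebra.Matrix

namespace Literature.Topology.FourManifolds

section Gompf

/-- **Gompf's conjecture for the trace `77`, inductive step by Iwaki's procedure (Lemma 5.2 = Kim–Yamada's Lemma 6.1), CONDITIONAL** (granted the
conjecture for the traces `-20`, `-14`, `-36`, `16`, `-21`, `-38`, `-10`, `24`, `22`, `-50`, `15` and the Gompf equivalence with `A₀` of the standard matrices of the undecided classes `(61, 253, 77)`, `(92, 149, 77)`, `(34, 145, 77)`): the non-trivial classes move by Gompf moves to the traces
`2` (from `(4, 5, 77)`), `2` (from `(9, 25, 77)`), `-20` (from `(35, 97, 77)`), `6` (from `(40, 71, 77)`), `3` (from `(14, 37, 77)`), `-14` (from `(75, 91, 77)`), `-36` (from `(40, 113, 77)`), `-1` (from `(7, 13, 77)`), `12` (from `(59, 65, 77)`), `-1` (from `(8, 13, 77)`), `16` (from `(41, 61, 77)`), (UNDECIDED: `(61, 253, 77)`, hypothesis), `-21` (from `(5, 49, 77)`), (UNDECIDED: `(92, 149, 77)`, hypothesis), `-5` (from `(27, 41, 77)`), `0` (from `(61, 77, 77)`), `-1` (from `(10,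 13, 77)`), `12` (from `(49, 65, 77)`), `-20` (from `(55, 97, 77)`), `8` (from `(15, 23, 77)`), `-38` (from `(84, 115, 77)`), `-10` (from `(5, 29, 77)`), (UNDECIDED: `(34, 145, 77)`, hypothesis), `0` (from `(5, 7, 77)`), `7` (from `(19, 35, 77)`), `24` (from `(47, 53, 77)`), `0` (from `(6, 11, 77)`), `22` (from `(39, 55, 77)`), `16` (from `(14, 61, 77)`), `16` (from `(22, 61, 77)`), `-50` (from `(68, 127, 77)`), `-14` (from `(33, 91, 77)`), `9` (from `(12, 17, 77)`), `15` (from `(30, 31, 77)`). [cite: Iwaki2025, §4.3 (Table, row n = 77) and §5.1 (Lemma 5.2; no chain is printed for the trace 77)] [cite: KimYamada2023, Lemma 6.1] -/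
theorem gompfConjectureForTrace_seventyseven_of
    (hneg20 : GompfConjectureForTrace (-20))
    (hneg14 : GompfConjectureForTrace (-14))
    (hneg36 : GompfConjectureForTrace (-36))
    (h16 : GompfConjectureForTrace (16))
    (hneg21 : GompfConjectureForTrace (-21))
    (hneg38 : GompfConjectureForTrace (-38))
    (hneg10 : GompfConjectureForTrace (-10))
    (h24 : GompfConjectureForTrace (24))
    (h22 : GompfConjectureForTrace (22))
    (hneg50 : GompfConjectureForTrace (-50))
    (h15 : GompfConjectureForTrace (15))
    (hX_61_253 : ∀ h : (253 : ℤ) ∣ (csPoly 77).eval 61, GompfEquiv (standardCSMatrix 61 253 77 h) akbulutKirbyMatrix)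
    (hX_92_149 : ∀ h : (149 : ℤ) ∣ (csPoly 77).eval 92, GompfEquiv (standardCSMatrix 92 149 77 h) akbulutKirbyMatrix)
    (hX_34_145 : ∀ h : (145 : ℤ) ∣ (csPoly 77).eval 34, GompfEquiv (standardCSMatrix 34 145 77 h) akbulutKirbyMatrix) : GompfConjectureForTrace 77 := by
  intro A hdet htr
  rcases isConj_standardCSMatrix_of_trace_eq_seventyseven A hdet htr with hc0 | hc1 | hc2 | hc3 | hc4 | hc5 | hc6 | hc7 | hc8 | hc9 | hc10 | hc11 | hc12 | hc13 | hc14 | hc15 | hc16 | hc17 | hc18 | hc19 | hc20 | hc21 | hc22 | hc23 | hc24 | hc25 | hc26 | hc27 | hc28 | hc29 | hc30 | hc31 | hc32 | hc33 | hc34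
  · exact (GompfEquiv.of_isConj hc0).trans (gompfEquiv_standardCSMatrix_one_one 75 (one_dvd _))
  · exact (GompfEquiv.of_isConj hc1).trans
      (gompfEquiv_standardCSMatrix_akbulutKirbyMatrix_of_modEq
        (gompfConjectureForTrace_of_mem_Icc_neg_seven_twelve (by norm_num)) rep0_dvd_eval_csPoly_seventyseven
        (show (77 : ℤ) ≡ 2 [ZMOD 5] by decide))
  · exact (GompfEquiv.of_isConj hc2).trans
      (gompfEquiv_standardCSMatrix_akbulutKirbyMatrix_of_modEq
        (gompfConjectureForTrace_of_mem_Icc_neg_seven_twelve (by norm_num)) rep1_dvd_eval_csPoly_seventyseven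
        (show (77 : ℤ) ≡ 2 [ZMOD 25] by decide))
  · exact (GompfEquiv.of_isConj hc3).trans
      (gompfEquiv_standardCSMatrix_akbulutKirbyMatrix_of_modEq
        hneg20 rep2_dvd_eval_csPoly_seventyseven
        (show (77 : ℤ) ≡ -20 [ZMOD 97] by decide))
  · exact (GompfEquiv.of_isConj hc4).trans
      (gompfEquiv_standardCSMatrix_akbulutKirbyMatrix_of_modEq
        (gompfConjectureForTrace_of_mem_Icc_neg_seven_twelve (by norm_num)) rep3_dvd_eval_csPoly_seventyseven
        (show (77 : ℤ) ≡ 6 [ZMOD 71] by decide))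
  · exact (GompfEquiv.of_isConj hc5).trans
      (gompfEquiv_standardCSMatrix_akbulutKirbyMatrix_of_modEq
        (gompfConjectureForTrace_of_mem_Icc_neg_seven_twelve (by norm_num)) rep4_dvd_eval_csPoly_seventyseven
        (show (77 : ℤ) ≡ 3 [ZMOD 37] by decide))
  · exact (GompfEquiv.of_isConj hc6).trans
      (gompfEquiv_standardCSMatrix_akbulutKirbyMatrix_of_modEq
        hneg14 rep5_dvd_eval_csPoly_seventyseven
        (show (77 : ℤ) ≡ -14 [ZMOD 91] by decide))
  · exact (GompfEquiv.of_isConj hc7).trans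
      (gompfEquiv_standardCSMatrix_akbulutKirbyMatrix_of_modEq
        hneg36 rep6_dvd_eval_csPoly_seventyseven
        (show (77 : ℤ) ≡ -36 [ZMOD 113] by decide))
  · exact (GompfEquiv.of_isConj hc8).trans
      (gompfEquiv_standardCSMatrix_akbulutKirbyMatrix_of_modEq
        (gompfConjectureForTrace_of_mem_Icc_neg_seven_twelve (by norm_num)) rep7_dvd_eval_csPoly_seventyseven
        (show (77 : ℤ) ≡ -1 [ZMOD 13] by decide))
  · exact (GompfEquiv.of_isConj hc9).trans
      (gompfEquiv_standardCSMatrix_akbulutKirbyMatrix_of_modEq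
        (gompfConjectureForTrace_of_mem_Icc_neg_seven_twelve (by norm_num)) rep8_dvd_eval_csPoly_seventyseven
        (show (77 : ℤ) ≡ 12 [ZMOD 65] by decide))
  · exact (GompfEquiv.of_isConj hc10).trans
      (gompfEquiv_standardCSMatrix_akbulutKirbyMatrix_of_modEq
        (gompfConjectureForTrace_of_mem_Icc_neg_seven_twelve (by norm_num)) rep9_dvd_eval_csPoly_seventyseven
        (show (77 : ℤ) ≡ -1 [ZMOD 13] by decide))
  · exact (GompfEquiv.of_isConj hc11).trans
      (gompfEquiv_standardCSMatrix_akbulutKirbyMatrix_of_modEq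
        h16 rep10_dvd_eval_csPoly_seventyseven
        (show (77 : ℤ) ≡ 16 [ZMOD 61] by decide))
  · exact (GompfEquiv.of_isConj hc12).trans (hX_61_253 _)
  · exact (GompfEquiv.of_isConj hc13).trans
      (gompfEquiv_standardCSMatrix_akbulutKirbyMatrix_of_modEq
        hneg21 rep12_dvd_eval_csPoly_seventyseven
        (show (77 : ℤ) ≡ -21 [ZMOD 49] by decide))
  · exact (GompfEquiv.of_isConj hc14).trans (hX_92_149 _)
  · exact (GompfEquiv.of_isConj hc15).trans
      (gompfEquiv_standardCSMatrix_akbulutKirbyMatrix_of_modEq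
        (gompfConjectureForTrace_of_mem_Icc_neg_seven_twelve (by norm_num)) rep14_dvd_eval_csPoly_seventyseven
        (show (77 : ℤ) ≡ -5 [ZMOD 41] by decide))
  · exact (GompfEquiv.of_isConj hc16).trans
      (gompfEquiv_standardCSMatrix_akbulutKirbyMatrix_of_modEq
        (gompfConjectureForTrace_of_mem_Icc_neg_seven_twelve (by norm_num)) rep15_dvd_eval_csPoly_seventyseven
        (show (77 : ℤ) ≡ 0 [ZMOD 77] by decide))
  · exact (GompfEquiv.of_isConj hc17).trans
      (gompfEquiv_standardCSMatrix_akbulutKirbyMatrix_of_modEq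
        (gompfConjectureForTrace_of_mem_Icc_neg_seven_twelve (by norm_num)) rep16_dvd_eval_csPoly_seventyseven
        (show (77 : ℤ) ≡ -1 [ZMOD 13] by decide))
  · exact (GompfEquiv.of_isConj hc18).trans
      (gompfEquiv_standardCSMatrix_akbulutKirbyMatrix_of_modEq
        (gompfConjectureForTrace_of_mem_Icc_neg_seven_twelve (by norm_num)) rep17_dvd_eval_csPoly_seventyseven
        (show (77 : ℤ) ≡ 12 [ZMOD 65] by decide))
  · exact (GompfEquiv.of_isConj hc19).trans
      (gompfEquiv_standardCSMatrix_akbulutKirbyMatrix_of_modEq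
        hneg20 rep18_dvd_eval_csPoly_seventyseven
        (show (77 : ℤ) ≡ -20 [ZMOD 97] by decide))
  · exact (GompfEquiv.of_isConj hc20).trans
      (gompfEquiv_standardCSMatrix_akbulutKirbyMatrix_of_modEq
        (gompfConjectureForTrace_of_mem_Icc_neg_seven_twelve (by norm_num)) rep19_dvd_eval_csPoly_seventyseven
        (show (77 : ℤ) ≡ 8 [ZMOD 23] by decide))
  · exact (GompfEquiv.of_isConj hc21).trans
      (gompfEquiv_standardCSMatrix_akbulutKirbyMatrix_of_modEq
        hneg38 rep20_dvd_eval_csPoly_seventyseven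
        (show (77 : ℤ) ≡ -38 [ZMOD 115] by decide))
  · exact (GompfEquiv.of_isConj hc22).trans
      (gompfEquiv_standardCSMatrix_akbulutKirbyMatrix_of_modEq
        hneg10 rep21_dvd_eval_csPoly_seventyseven
        (show (77 : ℤ) ≡ -10 [ZMOD 29] by decide))
  · exact (GompfEquiv.of_isConj hc23).trans (hX_34_145 _)
  · exact (GompfEquiv.of_isConj hc24).trans
      (gompfEquiv_standardCSMatrix_akbulutKirbyMatrix_of_modEq
        (gompfConjectureForTrace_of_mem_Icc_neg_seven_twelve (by norm_num)) rep23_dvd_eval_csPoly_seventyseven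
        (show (77 : ℤ) ≡ 0 [ZMOD 7] by decide))
  · exact (GompfEquiv.of_isConj hc25).trans
      (gompfEquiv_standardCSMatrix_akbulutKirbyMatrix_of_modEq
        (gompfConjectureForTrace_of_mem_Icc_neg_seven_twelve (by norm_num)) rep24_dvd_eval_csPoly_seventyseven
        (show (77 : ℤ) ≡ 7 [ZMOD 35] by decide))
  · exact (GompfEquiv.of_isConj hc26).trans
      (gompfEquiv_standardCSMatrix_akbulutKirbyMatrix_of_modEq
        h24 rep25_dvd_eval_csPoly_seventyseven
        (show (77 : ℤ) ≡ 24 [ZMOD 53] by decide))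
  · exact (GompfEquiv.of_isConj hc27).trans
      (gompfEquiv_standardCSMatrix_akbulutKirbyMatrix_of_modEq
        (gompfConjectureForTrace_of_mem_Icc_neg_seven_twelve (by norm_num)) rep26_dvd_eval_csPoly_seventyseven
        (show (77 : ℤ) ≡ 0 [ZMOD 11] by decide))
  · exact (GompfEquiv.of_isConj hc28).trans
      (gompfEquiv_standardCSMatrix_akbulutKirbyMatrix_of_modEq
        h22 rep27_dvd_eval_csPoly_seventyseven
        (show (77 : ℤ) ≡ 22 [ZMOD 55] by decide))
  · exact (GompfEquiv.of_isConj hc29).trans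
      (gompfEquiv_standardCSMatrix_akbulutKirbyMatrix_of_modEq
        h16 rep28_dvd_eval_csPoly_seventyseven
        (show (77 : ℤ) ≡ 16 [ZMOD 61] by decide))
  · exact (GompfEquiv.of_isConj hc30).trans
      (gompfEquiv_standardCSMatrix_akbulutKirbyMatrix_of_modEq
        h16 rep29_dvd_eval_csPoly_seventyseven
        (show (77 : ℤ) ≡ 16 [ZMOD 61] by decide))
  · exact (GompfEquiv.of_isConj hc31).trans
      (gompfEquiv_standardCSMatrix_akbulutKirbyMatrix_of_modEq
        hneg50 rep30_dvd_eval_csPoly_seventyseven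
        (show (77 : ℤ) ≡ -50 [ZMOD 127] by decide))
  · exact (GompfEquiv.of_isConj hc32).trans
      (gompfEquiv_standardCSMatrix_akbulutKirbyMatrix_of_modEq
        hneg14 rep31_dvd_eval_csPoly_seventyseven
        (show (77 : ℤ) ≡ -14 [ZMOD 91] by decide))
  · exact (GompfEquiv.of_isConj hc33).trans
      (gompfEquiv_standardCSMatrix_akbulutKirbyMatrix_of_modEq
        (gompfConjectureForTrace_of_mem_Icc_neg_seven_twelve (by norm_num)) rep32_dvd_eval_csPoly_seventyseven
        (show (77 : ℤ) ≡ 9 [ZMOD 17] by decide))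
  · exact (GompfEquiv.of_isConj hc34).trans
      (gompfEquiv_standardCSMatrix_akbulutKirbyMatrix_of_modEq
        h15 rep33_dvd_eval_csPoly_seventyseven
        (show (77 : ℤ) ≡ 15 [ZMOD 31] by decide))

/-- **The trace `-72`** (`= 5 - 77`), by Kim–Yamada's Theorem A, under the same hypotheses. [cite: KimYamada2023, Thm. A] [cite: Iwaki2025, §5.1] -/
theorem gompfConjectureForTrace_neg_seventytwo_of
    (hneg20 : GompfConjectureForTrace (-20))
    (hneg14 : GompfConjectureForTrace (-14))
    (hneg36 : GompfConjectureForTrace (-36))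
    (h16 : GompfConjectureForTrace (16))
    (hneg21 : GompfConjectureForTrace (-21))
    (hneg38 : GompfConjectureForTrace (-38))
    (hneg10 : GompfConjectureForTrace (-10))
    (h24 : GompfConjectureForTrace (24))
    (h22 : GompfConjectureForTrace (22))
    (hneg50 : GompfConjectureForTrace (-50))
    (h15 : GompfConjectureForTrace (15))
    (hX_61_253 : ∀ h : (253 : ℤ) ∣ (csPoly 77).eval 61, GompfEquiv (standardCSMatrix 61 253 77 h) akbulutKirbyMatrix)
    (hX_92_149 : ∀ h : (149 : ℤ) ∣ (csPoly 77).eval 92, GompfEquiv (standardCSMatrix 92 149 77 h) akbulutKirbyMatrix)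
    (hX_34_145 : ∀ h : (145 : ℤ) ∣ (csPoly 77).eval 34, GompfEquiv (standardCSMatrix 34 145 77 h) akbulutKirbyMatrix) : GompfConjectureForTrace (-72) := by
  have h := gompfConjectureForTrace_of_five_sub (gompfConjectureForTrace_seventyseven_of hneg20 hneg14 hneg36 h16 hneg21 hneg38 hneg10 h24 h22 hneg50 h15 hX_61_253 hX_92_149 hX_34_145)
  norm_num at h
  exact h

/-- **Gompf's conjecture for the trace `77` from Iwaki's three undecided classes alone**: every smaller-trace
hypothesis of `gompfConjectureForTrace_seventyseven_of` is a theorem of the tree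
(`gompfConjectureForTrace_neg_twenty`, `gompfConjectureForTrace_neg_fourteen`, `gompfConjectureForTrace_neg_thirtysix`, `gompfConjectureForTrace_sixteen`, `gompfConjectureForTrace_neg_twentyone`, `gompfConjectureForTrace_neg_thirtyeight`, `gompfConjectureForTrace_neg_ten`, `gompfConjectureForTrace_twentyfour`, `gompfConjectureForTrace_twentytwo`, `gompfConjectureForTrace_neg_fifty`, `gompfConjectureForTrace_fifteen`), so
`GompfConjectureForTrace 77` follows from `X_{61,253,77} ∼ A₀`, `X_{92,149,77} ∼ A₀`, `X_{34,145,77} ∼ A₀` (the three special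
classes of the trace `77`, Iwaki 2025, §4.3 ∕ §5.1, for which no chain is printed). [cite: Iwaki2025, §5.1 and §4.3 (Table, row 77)] -/
theorem gompfConjectureForTrace_seventyseven_of_undecided
    (h₁ : ∀ h : (253 : ℤ) ∣ (csPoly 77).eval 61, GompfEquiv (standardCSMatrix 61 253 77 h) akbulutKirbyMatrix)
    (h₂ : ∀ h : (149 : ℤ) ∣ (csPoly 77).eval 92, GompfEquiv (standardCSMatrix 92 149 77 h) akbulutKirbyMatrix)
    (h₃ : ∀ h : (145 : ℤ) ∣ (csPoly 77).eval 34, GompfEquiv (standardCSMatrix 34 145 77 h) akbulutKirbyMatrix) :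
    GompfConjectureForTrace 77 :=
  gompfConjectureForTrace_seventyseven_of gompfConjectureForTrace_neg_twenty gompfConjectureForTrace_neg_fourteen gompfConjectureForTrace_neg_thirtysix gompfConjectureForTrace_sixteen gompfConjectureForTrace_neg_twentyone gompfConjectureForTrace_neg_thirtyeight gompfConjectureForTrace_neg_ten gompfConjectureForTrace_twentyfour gompfConjectureForTrace_twentytwo gompfConjectureForTrace_neg_fifty gompfConjectureForTrace_fifteen h₁ h₂ h₃

/-- **The trace `-72 = 5 - 77` from the same three classes**, by Kim–Yamada's Theorem A. [cite: KimYamada2023, Thm. A] [cite: Iwaki2025, §5.1] -/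
theorem gompfConjectureForTrace_neg_seventytwo_of_undecided
    (h₁ : ∀ h : (253 : ℤ) ∣ (csPoly 77).eval 61, GompfEquiv (standardCSMatrix 61 253 77 h) akbulutKirbyMatrix)
    (h₂ : ∀ h : (149 : ℤ) ∣ (csPoly 77).eval 92, GompfEquiv (standardCSMatrix 92 149 77 h) akbulutKirbyMatrix)
    (h₃ : ∀ h : (145 : ℤ) ∣ (csPoly 77).eval 34, GompfEquiv (standardCSMatrix 34 145 77 h) akbulutKirbyMatrix) :
    GompfConjectureForTrace (-72) :=
  gompfConjectureForTrace_neg_seventytwo_of gompfConjectureForTrace_neg_twenty gompfConjectureForTrace_neg_fourteen gompfConjectureForTrace_neg_thirtysix gompfConjectureForTrace_sixteen gompfConjectureForTrace_neg_twentyone gompfConjectureForTrace_neg_thirtyeight gompfConjectureForTrace_neg_ten gompfConjectureForTrace_twentyfour gompfConjectureForTrace_twentytwo gompfConjectureForTrace_neg_fifty gompfConjectureForTrace_fifteen h₁ h₂ h₃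

/-- **Gompf's conjecture for the trace `77` ⟺ the three undecided standard matrices `X_{61,253,77}`, `X_{92,149,77}`, `X_{34,145,77}`
are Gompf equivalent to `A₀`** (⇒ is the conjecture applied to these matrices,
`GompfConjectureForTrace.standardCSMatrix`). [cite: Iwaki2025, §5.1 and §4.3 (Table, row 77)] -/
theorem gompfConjectureForTrace_seventyseven_iff :
    GompfConjectureForTrace 77 ↔
      (∀ h : (253 : ℤ) ∣ (csPoly 77).eval 61, GompfEquiv (standardCSMatrix 61 253 77 h) akbulutKirbyMatrix) ∧
        (∀ h : (149 : ℤ) ∣ (csPoly 77).eval 92, GompfEquiv (standardCSMatrix 92 149 77 h) akbulutKirbyMatrix) ∧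
        ∀ h : (145 : ℤ) ∣ (csPoly 77).eval 34, GompfEquiv (standardCSMatrix 34 145 77 h) akbulutKirbyMatrix :=
  ⟨fun hG => ⟨fun h => hG.standardCSMatrix h, fun h => hG.standardCSMatrix h, fun h => hG.standardCSMatrix h⟩,
    fun h => gompfConjectureForTrace_seventyseven_of_undecided h.1 h.2.1 h.2.2⟩

/-- **`(61, 253, 77)`, `(92, 149, 77)`, `(34, 145, 77)` are Cappell–Shaneson triples** (`253 ∣ f₇₇(61)`, `149 ∣ f₇₇(92)`, `145 ∣ f₇₇(34)`):
the three undecided standard matrices exist. [cite: Iwaki2025, §4.3 (Table, row 77)] -/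
theorem dvd_eval_csPoly_seventyseven_undecided :
    (253 : ℤ) ∣ (csPoly 77).eval 61 ∧ (149 : ℤ) ∣ (csPoly 77).eval 92 ∧ (145 : ℤ) ∣ (csPoly 77).eval 34 := by
  refine ⟨?_, ?_, ?_⟩ <;> norm_num [eval_csPoly]

/-- **The special class `(34, 145, 77)` moves to the trace `-68 = 5 - 73`** (`77 ≡ -68 (mod 145)`, one Gompf move,
Lemma 5.2): its Gompf equivalence with `A₀` follows from Gompf's conjecture at the trace `-68`.
[cite: Iwaki2025, Lemma 5.2 and §4.3 (Table, rows 73 and 77)] -/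
theorem gompfEquiv_standardCSMatrix_34_145_77_of_neg_sixtyeight (hG : GompfConjectureForTrace (-68))
    (h : (145 : ℤ) ∣ (csPoly 77).eval 34) : GompfEquiv (standardCSMatrix 34 145 77 h) akbulutKirbyMatrix :=
  gompfEquiv_standardCSMatrix_akbulutKirbyMatrix_of_modEq hG h (show (77 : ℤ) ≡ -68 [ZMOD 145] by decide)

/-- **Gompf's conjecture for the trace `77` from `X_{61,253,77} ∼ A₀`, `X_{92,149,77} ∼ A₀` and the four undecided
classes of the trace `73`**: the third special class `(34, 145, 77)` moves to the trace `-68 = 5 - 73`, where the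
conjecture is reduced to `X_{178,191,73} ∼ A₀`, `X_{23,145,73} ∼ A₀`, `X_{41,189,73} ∼ A₀`, `X_{23,171,73} ∼ A₀`
(`gompfConjectureForTrace_neg_sixtyeight_of_undecided`, `…ClassGroupSeventythreeGompf.lean`).
[cite: Iwaki2025, §5.1 (Lemma 5.2) and §4.3 (Table, rows 73 and 77)] [cite: KimYamada2023, Thm. A] -/
theorem gompfConjectureForTrace_seventyseven_of_seventythree_undecided
    (h73₁ : ∀ h : (191 : ℤ) ∣ (csPoly 73).eval 178, GompfEquiv (standardCSMatrix 178 191 73 h) akbulutKirbyMatrix)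
    (h73₂ : ∀ h : (145 : ℤ) ∣ (csPoly 73).eval 23, GompfEquiv (standardCSMatrix 23 145 73 h) akbulutKirbyMatrix)
    (h73₃ : ∀ h : (189 : ℤ) ∣ (csPoly 73).eval 41, GompfEquiv (standardCSMatrix 41 189 73 h) akbulutKirbyMatrix)
    (h73₄ : ∀ h : (171 : ℤ) ∣ (csPoly 73).eval 23, GompfEquiv (standardCSMatrix 23 171 73 h) akbulutKirbyMatrix)
    (h₁ : ∀ h : (253 : ℤ) ∣ (csPoly 77).eval 61, GompfEquiv (standardCSMatrix 61 253 77 h) akbulutKirbyMatrix)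
    (h₂ : ∀ h : (149 : ℤ) ∣ (csPoly 77).eval 92, GompfEquiv (standardCSMatrix 92 149 77 h) akbulutKirbyMatrix) :
    GompfConjectureForTrace 77 :=
  gompfConjectureForTrace_seventyseven_of_undecided h₁ h₂ fun h =>
    gompfEquiv_standardCSMatrix_34_145_77_of_neg_sixtyeight
      (gompfConjectureForTrace_neg_sixtyeight_of_undecided h73₁ h73₂ h73₃ h73₄) h

end Gompf

end Literature.Topology.FourManifolds

end
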